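import Summits.QuantumFields.BalabanUV.T4Continuum.Support.RegionStarLineGaugeEnd
import Summits.QuantumFields.BalabanUV.T4Continuum.Support.DirichletStarClassPoincare

/-!
# `BalabanUV.T4Continuum.Support.RegionStarLineGaugeTower` — NE2 (node U1a) formalisation swarm, SUPPLIER item «Δ1-COERC-ORTH-LINE» under the
# owner's sub-row `T4-U1a.S-NE2-D1-DIRICHLET°` (vector layer, W1): THE W1 SOCKET OF THE STAR-BOND TOWERS DISCHARGED ON EVERY `e`-THIN BLOCK SET,
# AT EVERY LEVEL (including the unit lattice `n = 1`) — the owner's `towerLimitRate_star_of_linear` (King's compressed pairing) and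
# leaf-07-g7's `towerLimitRate_star_renorm_of_interior` (renormalised pairing) with `hS : ∀ k, SliceCoercive …_k c` SUPPLIED BY NAME
# (unit b2b-balaban-t4-ne2-formalise-leaf-09, gen 9, v1)

HONEST FRAMING (T4-DAG p. 1).  [folklore] `U = 1`, ONE region of the class `IsEThin e S` (single blocks, thickness-one `e`-slabs, rods, staggered
cylinders), finite torus with `2 ≤ M e`; JUNCTION bookkeeping: the W1 binder of the two star-bond tower ENDs of record is discharged on that class
from `RegionStarLineGaugeEnd.sliceCoercive_of_isEThin` plus the trivial unit-lattice level; what stays displayed in those ENDs stays displayed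
(interior∕zero-extension W2, W3̃∕W3); W1 for general unions OPEN; nothing printed is a hypothesis; NE2 (U1a) NOT proved; spine PROVED 0/9
unchanged; NOT [B9] (3.23)–(3.27) as printed; NOT infinite volume, NOT the mass gap, NOT Clay.  HONEST DEPENDENCY (verbatim): «continuum YM on T⁴
⇐ BetaPertH ∧ nine spine estimates (0/9 proved); BetaPertH ⇐ (D1) ∧ (D4) ∧ CAP+tail; G-an2-4 gates asym, D1 and NE2/3/4.»

WHAT THIS FILE PROVES (0 sorry):
 * §1 THE UNIT-LATTICE LEVEL `n = 1` (where every block is one site and the residual gauge orbit is trivial): `QvOp_one_apply`, `nsq_QvOp_one`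
   (`nsq (Q Z) = nsq Z` at `n = 1` — Bałaban's averaging is the identity), **`orthSlice_one`** (`OrthSliceCoercive … (a·1^d) c` for every `c ≤ a`).
 * §2 `orbitConst_le` (`orbitConst d a C₁ C₂ ≤ a` for `0 ≤ C₂`, since `Cext d ≥ 216`) and the ALL-LEVEL versions **`orthSlice_of_isEThin'`**,
   **`sliceCoercive_of_isEThin'`**, `coercive_regionDeltaA_of_isEThin'` — the gen-9 ENDs without the side condition `2 ≤ n` (case split `n = 1` ∕ `n ≥ 2`),
   with the named constant `thinConst d a a′ = orbitConst d a 40 16 / (1 + 4d/σ₀(d,a′))`.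
 * §3 THE JUNCTIONS: **`towerLimitRate_star_renorm_of_interior_isEThin`** = leaf-07-g7's `towerLimitRate_star_renorm_of_interior` with `hc`∕`hS`
   SUPPLIED (renormalised pairing: the defect-free star tower of the faithful `Δ_a(Ω₀)` on an `e`-thin region converges at the TORUS RATE `L⁻¹`
   modulo the interior gradient-form bound and W3̃ ONLY), and **`towerLimitRate_star_of_linear_isEThin`** = the owner's `towerLimitRate_star_of_linear`
   with `hc`∕`hS` SUPPLIED (King's compressed pairing, rate θ ≥ (√L)⁻¹ modulo the zero-extension W2 class and W3 only).

ABSOLUTE RULE (cell, verbatim): «No internally-minted statement may enter as a cited fact. Every hypothesis is either kernel-proved in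
this package or a verbatim quotation of a PUBLISHED theorem with page reference. The manuscript(s) under audit are NOT citable for
their own disputed steps — they are the thing under adjudication; programme-internal (2001/route/tribunal) claims are never citable.»
[folklore] throughout; one real constant `thinConst`; no `def … : Prop`.  NOT CLAIMED: the remaining displayed binders; W1 beyond `e`-thin sets; NE2; NE3.
-/

noncomputable section

open scoped BigOperators ComplexConjugate Matrix Matrix.Norms.L2Operator
open Finset

namespace Summit.QuantumFields.BalabanUV.T4Continuum.RegionStarLineGaugeTower

open Literature.MathematicalPhysics.QuantumFieldTheory.Balaban1983to89.B5Prop11Plancherel (Tor fine unitVec fdiff)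
open Literature.MathematicalPhysics.QuantumFieldTheory.Balaban1983to89.B5Prop11Lower (nsq nsq_nonneg)
open Literature.MathematicalPhysics.QuantumFieldTheory.Balaban1983to89.B5Block118 (bpt tstep tstep_zero lineSum QvOp QvOp_mulVec)
open Literature.MathematicalPhysics.QuantumFieldTheory.Balaban1983to89.B5G183RateUnitTower (lev)
open Summit.QuantumFields.BalabanUV.T4Continuum
open Summit.QuantumFields.BalabanUV.T4Continuum.CovariantAveragingTower (TowerLimitRate)
open Summit.QuantumFields.BalabanUV.T4Continuum.BackgroundResolventTower
open Summit.QuantumFields.BalabanUV.T4Continuum.SubtypeCompression (Coercive ext nsq_ext)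
open Summit.QuantumFields.BalabanUV.T4Continuum.ScalarAveragedPropagator (gammaPs)
open Summit.QuantumFields.BalabanUV.T4Continuum.ScalarAveragedCompression (sigma0 sigma0_pos)
open Summit.QuantumFields.BalabanUV.T4Continuum.RegionScalarCompression (QOm GOm)
open Summit.QuantumFields.BalabanUV.T4Continuum.RegionGaugeFixedVector (starReg curlR gradR avgR regionDeltaA)
open Summit.QuantumFields.BalabanUV.T4Continuum.RegionGaugeFixedVectorFlat (avgR_mulVec)
open Summit.QuantumFields.BalabanUV.T4Continuum.RegionGaugeSlice (SliceCoercive)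
open Summit.QuantumFields.BalabanUV.T4Continuum.RegionGaugeSliceOrth (OrthSliceCoercive)
open Summit.QuantumFields.BalabanUV.T4Continuum.RegionGaugeSliceOrthRegion (sliceCoercive_region_of_orthSlice coercive_regionDeltaA_of_orthSlice)
open Summit.QuantumFields.BalabanUV.T4Continuum.RegionGaugeOrbit (orbitConst orbitConst_pos)
open Summit.QuantumFields.BalabanUV.T4Continuum.RegionBlockExtension (Cext)
open Summit.QuantumFields.BalabanUV.T4Continuum.RegionStarLineGaugeRegion (IsEThin)
open Summit.QuantumFields.BalabanUV.T4Continuum.RegionStarLineGaugeEnd (orthSlice_of_isEThin)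
open Summit.QuantumFields.BalabanUV.T4Continuum.DirichletSubregionTowerOf (pidx QpR JpR)
open Summit.QuantumFields.BalabanUV.T4Continuum.DirichletSubregionRenormTower (JnR AnR)
open Summit.QuantumFields.BalabanUV.T4Continuum.DirichletStarVectorTower (starP gamStar fStar towerLimitRate_star_of_linear)
open Summit.QuantumFields.BalabanUV.T4Continuum.DirichletStarRenormTower (igrad)
open Summit.QuantumFields.BalabanUV.T4Continuum.DirichletStarClassPoincare (towerLimitRate_star_renorm_of_interior)
open Summit.QuantumFields.BalabanUV.Beta.GAN24.DirichletBoxTrace (blockReg sum_eq_sum_bpt)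

variable {d : ℕ} (M : Fin d → ℕ) [hM : ∀ μ, NeZero (M μ)]

/-! ## §1 The unit-lattice level `n = 1` -/

/-- at `n = 1` Bałaban's vector averaging is the identity: `(Q Z)(y, μ) = Z(y, μ)` (the block `B(y)` is the single site `bpt 1 M y 0`).
[cite: Balaban1984PropagatorsI, (1.18) p.20 (shape)] [folklore] -/
theorem QvOp_one_apply (Z : Tor (fine 1 M) × Fin d → ℂ) (y : Tor M) (μ : Fin d) :
    (QvOp 1 M *ᵥ Z) (y, μ) = Z (bpt 1 M y default, μ) := by
  rw [QvOp_mulVec, Fintype.sum_unique, lineSum, Fintype.sum_unique, Fin.val_eq_zero, tstep_zero, add_zero, Nat.cast_one, one_pow,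
    div_one, one_mul]

/-- hence `nsq (Q Z) = nsq Z` at `n = 1`. [folklore] -/
theorem nsq_QvOp_one (Z : Tor (fine 1 M) × Fin d → ℂ) : nsq (QvOp 1 M *ᵥ Z) = nsq Z := by
  unfold nsq
  rw [Fintype.sum_prod_type, Fintype.sum_prod_type, sum_eq_sum_bpt 1 M (fun x => ∑ μ, ‖Z (x, μ)‖ ^ 2)]
  refine sum_congr rfl fun y _ => ?_
  conv_rhs => rw [Fintype.sum_unique]
  exact sum_congr rfl fun μ _ => by rw [QvOp_one_apply]

variable (S : Tor M → Prop) [DecidablePred S] (a a' : ℝ)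

/-- at `n = 1`, `nsq (avgR A) = nsq A` on the star bonds. [folklore] -/
theorem nsq_avgR_one (A : {b // starReg 1 M S b} → ℂ) : nsq (avgR 1 M S *ᵥ A) = nsq A := by
  rw [avgR_mulVec, nsq_QvOp_one, nsq_ext]

/-- **W1 AT THE UNIT-LATTICE LEVEL**: `OrthSliceCoercive (curlR 1 M S) … (a·1^d) c` for every `c ≤ a` (the mass term alone pays). [folklore] -/
theorem orthSlice_one {c : ℝ} (hca : c ≤ a) :
    OrthSliceCoercive (curlR 1 M S) (gradR 1 M S) (QOm 1 M S) (avgR 1 M S) (a * ((1 : ℕ) : ℝ) ^ d) c := by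
  intro A _
  rw [nsq_avgR_one, Nat.cast_one, one_pow, mul_one]
  have h1 := nsq_nonneg (curlR 1 M S *ᵥ A)
  have h2 := nsq_nonneg A
  nlinarith

/-! ## §2 All levels -/

/-- `216 ≤ Cext d`. [folklore] -/
theorem Cext_ge (d : ℕ) : 216 ≤ Cext d := by
  unfold Cext
  have h1 : (0 : ℝ) ≤ 2 * (d : ℝ) ^ 2 * (16 : ℝ) ^ d := by positivity
  have h2 : (0 : ℝ) ≤ 8 * (d : ℝ) ^ 2 * (576 : ℝ) ^ d := by positivity
  nlinarith

/-- the W1 constant of the orbit reduction never exceeds the coupling: `orbitConst d a C₁ C₂ ≤ a` (`0 < a`, `0 ≤ C₂`). [folklore] -/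
theorem orbitConst_le {a C₁ C₂ : ℝ} (ha : 0 < a) (hC₂ : 0 ≤ C₂) : orbitConst d a C₁ C₂ ≤ a := by
  have hC := Cext_ge d
  unfold orbitConst
  have hK : a⁻¹ ≤ max ((2 + 4 * Cext d) * C₁) (((2 + 4 * Cext d) * C₂ + 4 * Cext d) / a) := by
    refine le_trans ?_ (le_max_right _ _)
    rw [inv_eq_one_div, div_le_div_iff_of_pos_right ha]
    nlinarith
  calc (max ((2 + 4 * Cext d) * C₁) (((2 + 4 * Cext d) * C₂ + 4 * Cext d) / a))⁻¹ ≤ (a⁻¹)⁻¹ :=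
        inv_anti₀ (inv_pos.mpr ha) hK
    _ = a := inv_inv a

/-- the named W1 constant of the `e`-thin class: `thinConst d a a′ = orbitConst d a 40 16 / (1 + 4d/σ₀(d,a′))`. [folklore] -/
def thinConst (d : ℕ) (a a' : ℝ) : ℝ := orbitConst d a 40 16 / (1 + 4 * d / sigma0 d a')

/-- `0 < thinConst d a a′` (`0 < a`, `0 < a′`). [folklore] -/
theorem thinConst_pos (ha : 0 < a) (ha' : 0 < a') : 0 < thinConst d a a' := by
  unfold thinConst
  have := sigma0_pos (d := d) ha'
  have := orbitConst_pos d (C₁ := 40) (C₂ := 16) ha (by norm_num)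
  positivity

variable (n : ℕ) [NeZero n] (e : Fin d)
variable {S}

/-- **THE DISPLAYED W1 INEQUALITY ON EVERY `e`-THIN BLOCK SET, EVERY LEVEL `n ≥ 1`** (`n = 1`: §1; `n ≥ 2`: the line gauge). [folklore] -/
theorem orthSlice_of_isEThin' (h : IsEThin M e S) (ha : 0 < a) :
    OrthSliceCoercive (curlR n M S) (gradR n M S) (QOm n M S) (avgR n M S) (a * (n : ℝ) ^ d) (orbitConst d a 40 16) := by
  by_cases hn : 2 ≤ n
  · exact orthSlice_of_isEThin n M e S a h hn ha
  · obtain rfl : n = 1 := by have := NeZero.ne n; omega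
    exact orthSlice_one M S a (orbitConst_le ha (by norm_num))

/-- **`SliceCoercive` ON EVERY `e`-THIN BLOCK SET, EVERY LEVEL `n ≥ 1`**, constant `thinConst d a a′`. [folklore] -/
theorem sliceCoercive_of_isEThin' (h : IsEThin M e S) (ha : 0 < a) (ha' : 0 < a') :
    SliceCoercive (curlR n M S) (gradR n M S) (GOm n M a' S) (QOm n M S) (avgR n M S) (a * (n : ℝ) ^ d) (thinConst d a a') :=
  sliceCoercive_region_of_orthSlice n M a a' S ha' (orbitConst_pos d ha (by norm_num)).le (orthSlice_of_isEThin' M a n e h ha)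

/-- a coercivity constant of `Δ_a(Ω₀)` on every `e`-thin block set, every level. [folklore] -/
theorem coercive_regionDeltaA_of_isEThin' (h : IsEThin M e S) (ha : 0 < a) (ha' : 0 < a') :
    Coercive (regionDeltaA n M a a' S) (min (thinConst d a a' / 2) (1 / (2 * (gammaPs d a')⁻¹))) :=
  coercive_regionDeltaA_of_orthSlice n M a a' S ha' (orbitConst_pos d ha (by norm_num)) (orthSlice_of_isEThin' M a n e h ha)

/-! ## §3 The junctions with the star-bond tower ENDs of record -/

variable (L : ℕ) [NeZero L] (S)

/-- **RENORMALISED PAIRING, `e`-THIN REGION**: leaf-07-g7's `towerLimitRate_star_renorm_of_interior` with the W1 binder `hS` SUPPLIED — the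
defect-free star tower of the faithful `Δ_a(Ω₀)` converges at the TORUS RATE `L⁻¹` modulo ONE level-uniform interior gradient-form constant and
the injected law W3̃ only. [folklore] -/
theorem towerLimitRate_star_renorm_of_interior_isEThin (h : IsEThin M e S) (ha : 0 < a) (ha' : 0 < a') {CgI : ℝ} (hCgI : 0 ≤ CgI)
    (hI : ∀ (k : ℕ) (w : pidx L M (starP L M S) (k + 1) → ℂ),
      ∑ μ, nsq (igrad M S (lev L (k + 1)) μ w) ≤ CgI * (star w ⬝ᵥ (regionDeltaA (lev L (k + 1)) M a a' S *ᵥ w)).re)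
    (hL : 2 ≤ L) {C₁ : ℝ}
    (hinj : ∀ k, ‖(regionDeltaA (lev L (k + 1)) M a a' S)⁻¹ * JnR L M (starP L M S) k
        - JnR L M (starP L M S) k * (regionDeltaA (lev L k) M a a' S)⁻¹‖ ≤ C₁ * ((L : ℝ)⁻¹) ^ k) :
    TowerLimitRate (AnR L M (starP L M S)) ((L : ℝ) ^ d) (fun k => (regionDeltaA (lev L k) M a a' S)⁻¹)
      (Cpert 0 (Real.sqrt (CgI / 2 * (gamStar d a' (thinConst d a a'))⁻¹)) C₁ 0 0 0) ((L : ℝ)⁻¹) :=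
  towerLimitRate_star_renorm_of_interior L M S a a' ha' (thinConst_pos a a' ha ha')
    (fun k => sliceCoercive_of_isEThin' M a a' (lev L k) e h ha ha') hCgI hI hL hinj

/-- **KING's COMPRESSED PAIRING, `e`-THIN REGION**: the owner's `towerLimitRate_star_of_linear` with the W1 binder `hS` SUPPLIED — rate `θ ≥ (√L)⁻¹`
modulo the zero-extension gradient-form class `Cg k ≤ Cg₀·L^k` and W3 only. [folklore] -/
theorem towerLimitRate_star_of_linear_isEThin (h : IsEThin M e S) (hL : 2 ≤ L) (ha : 0 < a) (ha' : 0 < a')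
    {Cg : ℕ → ℝ} {Cg₀ : ℝ} (hCg : ∀ k, 0 ≤ Cg k) (hCg₀ : ∀ k, Cg k ≤ Cg₀ * (L : ℝ) ^ k)
    (hgrad : ∀ (k : ℕ) (ν : Fin d) (w : pidx L M (starP L M S) k → ℂ),
      nsq (fdiff (fine (lev L k) M) ((lev L k : ℕ) : ℂ) ν *ᵥ ext (starP L M S k) w)
        ≤ Cg k * (star w ⬝ᵥ (regionDeltaA (lev L k) M a a' S *ᵥ w)).re)
    {θ C₁ : ℝ} (hθ : (Real.sqrt L)⁻¹ ≤ θ) (hθ1 : θ < 1)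
    (hinj : ∀ k, ‖(regionDeltaA (lev L (k + 1)) M a a' S)⁻¹ * JpR L M (starP L M S) k
        - JpR L M (starP L M S) k * (regionDeltaA (lev L k) M a a' S)⁻¹‖ ≤ C₁ * θ ^ k) :
    TowerLimitRate (QpR L M (starP L M S)) ((L : ℝ) ^ d) (fun k => (regionDeltaA (lev L k) M a a' S)⁻¹)
      (Cpert 0 (2 * d * Real.sqrt (Cg₀ * L * (gamStar d a' (thinConst d a a'))⁻¹)) C₁ 0
        ((gamStar d a' (thinConst d a a'))⁻¹ + Real.sqrt (d * (Cg₀ * L) * (gamStar d a' (thinConst d a a'))⁻¹)) 0) θ :=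
  towerLimitRate_star_of_linear L M a a' S hL ha' (thinConst_pos a a' ha ha')
    (fun k => sliceCoercive_of_isEThin' M a a' (lev L k) e h ha ha') hCg hCg₀ hgrad hθ hθ1 hinj

end Summit.QuantumFields.BalabanUV.T4Continuum.RegionStarLineGaugeTower

end
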